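/-
Copyright (c) 2026. All rights reserved.
Released under Apache 2.0 license as described in the file LICENSE.
-/
import Literature.Geometry.Kaehler.ComplexTorusQuaternionXSixSpecialCyclesScaling
import Literature.Geometry.Kaehler.ComplexTorusQuaternionRamifiedIdealCRT
import HarnessLib

/-!
# The Atkin–Lehner involutions `ω₂, ω₃, ω₆` on the special points of `X₆`: `ω₂` fixes the two order-`2` points and
# swaps `P₂ ↔ P₄`, `P₀ ↔ P₇`; `ω₃` swaps `P₆ ↔ P₁₃₅`, fixes `P₂, P₄`, swaps `P₀ ↔ P₇`; `ω₆` swaps, swaps and fixes the two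
# SCM points `P₀`, `P₇` — Bayer–Travesa's polygon identifications (2007, §2) read on special vectors, with the cosets
# `{g ∈ O₆ : nr g = d} = Γ₆·w_d`, the non-fixedness obstructions and the isotropy elements of order `4, 6, 2` on `X₆⁺`

[tag: complex_torus] [tag: abelian_surface] [tag: quaternion_multiplication] [tag: complex_multiplication]
[tag: shimura_curve] [tag: special_cycles] [tag: atkin_lehner] [tag: elliptic_points]

Lane `lit-hodgefound`, seat p12, row g32-#3 — THEOREMS ONLY (no definition, no named fact, no instance); the sequel of g31-#10
`…XSixLOneClasses` (`L(1)/Γ₆ = {[±i], [±E]}`, `E = −2i + ij`), g31-#11 `…XSixLThreeClasses` (`L(3)/Γ₆ = {[R₁], …, [R₄]}`,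
`R₁ = 3i + j + ij`, `R₂ = 3i + j − ij`), g32-#1 `…XSixLSixClasses` (`L(6)/Γ₆ = {[S₁], …, [S₄]}`, `S₁ = 3i + j`, `S₂ = 3i + ij`),
g31-#3/#6 (`P₂ = O₆(1 + i)`, `P₃ = O₆μ`, `P₂ ∩ P₃ = O₆w₆`, `μ = 3 + j + ij`, `w₆ = (1 + i)μ = 3 + 3i + 2ij`) and g31-#1
(`u(1 + i)ᵏμˡ` normalises `𝔬`, `N(𝔬) ⊆ N(O₆)`). Setting: `B = (−1,3)_ℚ`, `𝔬 = ℤ⟨1, i, j, ij⟩`, `O₆` as the predicate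
`x ∈ 𝔬 ∨ x − e ∈ 𝔬`, `Γ₆ = O₆¹`, `X₆ = Γ₆∖ℌ`; the points of `X₆` attached to special vectors: `P₆ = z_i`, `P₁ ≡ P₃ ≡ P₅ =
z_{±E}` (order `2`), `P₄ = z_{R₁}`, `P₂ = z_{R₂}` (order `3`), `P₇ ≡ P₈ = z_{S₁}`, `P₀ = z_{S₂}` (SCM) — g29–g32. A point of `X₆`
carried by a special vector `x` is the `Γ₆`-class of the pair `±x` (KRY (3.4.13)); an element `g ∈ N(O₆)` of positive norm
acts on `ℌ` and sends `z_x ↦ z_{gxg⁻¹}`; so **«`ω_d(P_x) = P_y`» is read as «some `g ∈ O₆` with `nr g = d` has `g x = ±y′ g`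
with `y′ ∈ Γ₆·y`»**, justified by §1 (`{g ∈ O₆ : nr g = d} = Γ₆·w_d`).

## The print, VERBATIM

* P. Bayer, A. Travesa (2007) [BayerTravesa2007] §2 pp. 318–319: «Let `N(O₆)` be the normalizer of `O₆` in `H₆`. The
  elements of `N(O₆)` of positive reduced norm define a subgroup whose image in `GL⁺(2, ℝ)` will be denoted by `Γ₆⁺`.
  The group `Γ₆` is contained in `Γ₆⁺` as a normal subgroup and the quotient `Γ₆⁺/Γ₆` is isomorphic to `(ℤ/2ℤ)²`. Its
  classes are represented by elements `w_d ∈ O₆` of norm `d` dividing `D = 6`. They give rise to involutions of the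
  curve `X₆`, denoted `ω_d` … consider the elements `w₂ := 1 + J`, `w₃ := (−3 − I − 3J + K)/2`, `w₃′ := (3 + I − 3J +
  K)/2`, and `w₆ := w₂w₃ = −3J + K` in `O₆` … we have the following polygon identifications: `ω₂[P₁, P₂, P₆] = [P₃, P₄,
  P₆]`, `ω₂[P₂, P₃, P₆] = [P₄, P₅, P₆]`, `ω₃[P₂, P₃, P₆] = [P₂, P₆, P₁]`, `ω₃′[P₃, P₄, P₆] = [P₆, P₄, P₅]`, `ω₆[P₂, P₃, P₆] =
  [P₄, P₆, P₃]`»; Prop. 2.1 (`X₆^{(6)}`, (a)): «`ω₆[P₀, P₃] = [P₀, P₆]`»; §7 p. 332: «Observe that `P₀` is an elliptic point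
  for `X₆^{(6)}` and `X₆⁺`, but it is not elliptic for `X₆`, `X₆^{(2)}` and `X₆^{(3)}`»; Table 9 (the triangle `[P₀, P₄,
  P₆]` of `t₆⁺`): `e_{P₀} = 2`, `e_{P₄} = 6`, `e_{P₆} = 4`.
* S. Kudla, M. Rapoport, T. Yang (2006) [KudlaRapoportYang2006] §3.4 Remark 3.4.7: «the group of Atkin–Lehner involutions
  permutes the components transitively»; (3.4.13); Lemma 3.4.3.
* A. P. Ogg (1983) [Ogg1983RealPoints] §2 p. 283: «`I(m) = μ𝒪 = 𝒪μ`, where `μ ∈ 𝒪` has norm `m` … Hence `μ` defines an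
  automorphism `w(m)` of `𝒪` with `w(m)² = 1`, called the Atkin–Lehner involution».

Dictionary (g30-#4): `I = j`, `J = −i`, `K = ij`; so `w₂ = 1 − i`, `w₃ = (−3 + 3i − j + ij)/2`, `w₃′ = (3 + 3i + j + ij)/2`,
`w₆ = 3i + ij = S₂`.

## What is proved

* §1 **DICTIONARY AND COSETS**: `w₂ = (−i)(1 + i)`, `w₃ = v₃μ`, `w₃′ = v₃′μ`, `w₆ = S₂ = v₆·(1 + i)μ` with `v₃, v₃′, v₆ ∈ O₆¹`,
  `w₂w₃ = w₆` (`bt_elements`); **`{g ∈ O₆ : nr g = d} = Γ₆·w_d`** for `d = 2, 3, 6` (`norm_two_iff_coset`, `norm_three_iff_coset`,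
  `norm_six_iff_coset`); every such `g` normalises `O₆` (`normalises_maxOrder_of_norm`); `ω_d² = 1`: `(1 + i)² = 2i`, `μ² =
  3(5 + 2j + 2ij)`, `w₆² = 6(2 + 3i + 2ij)` with unit cofactors (`atkinLehner_sq`).
* §2 **OBSTRUCTIONS**: an element of non-negative… precisely: `gx = −xg` for a special vector `x` (`Q(x) > 0`) forces `nr g ≤ 0`
  (`norm_nonpos_of_anticommute`: `x^⊥ ⊂ V` is negative definite); commuting elements lie in `ℚ(x)` with its norm form.
* §3 **THE TABLE** (`omega_two_table`, `omega_three_table`, `omega_six_table`), explicit `g ∈ O₆` of norm `d` with `gx = yg`: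
  `ω₂`: `i ↦ i` (`1 + i`), `E ↦ E` (`1 + 2i − ij`), `R₁ ↦ R₂` (`1 − i`), `R₂ ↦ R₁`, `S₁ ↦ S₂` (`1 + i`), `S₂ ↦ S₁` (`1 − i`);
  `ω₃`: `i ↦ −E`, `E ↦ −i` (`(3 + 3i ± j ∓ ij)/2`… see the statements), `R₁ ↦ R₁` (`w₃′`!), `R₂ ↦ R₂`, `S₁ ↦ S₂`, `S₂ ↦ S₁`;
  `ω₆`: `i ↦ −E` (`3 + j`), `E ↦ −i` (`3 − j`), `R₁ ↦ R₂` (`3 + j`), `R₂ ↦ R₁` (`3 − j`), `S₁ ↦ S₁` (`S₁` itself), `S₂ ↦ S₂` (`S₂ =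
  w₆` itself). On points: **`ω₂` fixes `P₆` and `P₁₃₅`, swaps `P₂ ↔ P₄`, `P₀ ↔ P₇`; `ω₃` swaps `P₆ ↔ P₁₃₅`, fixes `P₂`, `P₄`,
  swaps `P₀ ↔ P₇`; `ω₆` swaps `P₆ ↔ P₁₃₅`, `P₂ ↔ P₄`, fixes `P₀`, `P₇`** — Bayer–Travesa's `ω₂[P₁, P₂, P₆] = [P₃, P₄, P₆]`,
  `ω₃[P₂, P₃, P₆] = [P₂, P₆, P₁]`, `ω₆[P₂, P₃, P₆] = [P₄, P₆, P₃]`, `ω₆(P₀) = P₀`.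
* §4 **NON-FIXEDNESS** (universal): no `g ∈ O₆` of norm `2` or `3` commutes or anticommutes with `S₁` or `S₂` (`n₀² + 6n² ∈
  {8, 12}`): **«`P₀` is an elliptic point for `X₆^{(6)}` and `X₆⁺`, but not for `X₆^{(2)}`, `X₆^{(3)}`»** (and not for `X₆`:
  g32-#1 `unit_commute_norm_six_eq`); none of norm `3` or `6` with `i` or `E` (`n₀² + n₁² ∈ {12, 24}`); none of norm `2` or `6`
  with `R₁` or `R₂` (`n₀² + 3n² ∈ {8, 24}`).
* §5 **ISOTROPY ON `X₆⁺`** (elements of `Stab_{N(O₆)}(z)` of the printed orders modulo `ℚ^×`): `(1 + i)² = 2i ∉ ℚ`, `(1 + i)⁴ =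
  −4` at `P₆` (`e = 4`); `S₂² = −6` at `P₀` (`e = 2`); `(R₁u₄)³ = 3R₁ ∉ ℚ`, `(R₁u₄)² ∉ ℚ`, `(R₁u₄)⁶ = −27` at `P₄`, `u₄ = (1 + R₁)/2`
  (`e = 6`).

## Honest scope

Points are handled as `±`-pairs of `Γ₆`-classes of special vectors (KRY (3.4.13)); no action on a quotient TYPE is built.
That `Γ₆{1, w₂, w₃, w₆}` is ALL of `N(O₆)` (`Γ₆⁺/Γ₆ ≅ (ℤ/2ℤ)²`) and the EXACT isotropy orders of Table 9 stay cited (§5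
exhibits elements of those orders only). 0 definitions, 0 named facts, 0 instances — net debt `0`.

## References
* [BayerTravesa2007] P. Bayer, A. Travesa, *Uniformizing functions for certain Shimura curves, in the case D = 6*, Acta
  Arith. 126 (2007), §1 Thm. 1.1, Table 1; §2 pp. 318–319, Prop. 2.1, Prop. 2.2; §7 p. 332; Table 9.
* [KudlaRapoportYang2006] S. Kudla, M. Rapoport, T. Yang, *Modular Forms and Special Cycles on Shimura Curves* (2006),
  §3.4 Lemma 3.4.3, Remark 3.4.7, (3.4.13).
* [Ogg1983RealPoints] A. P. Ogg, *Real points on Shimura curves*, Progr. Math. 35 (1983), §2 p. 283.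
-/

noncomputable section

set_option maxSynthPendingDepth 3

open Quaternion Function

namespace Literature.Geometry.Kaehler.ComplexTorus.QuaternionType

section AtkinLehnerPoints

/-! ## §1 The Atkin–Lehner elements: dictionary, cosets, normalising, involutivity -/

/-- **BAYER–TRAVESA'S `w₂, w₃, w₃′, w₆` IN THE TREE'S COORDINATES**: `w₂ = 1 + J = 1 − i = (−i)·(1 + i)`; `w₃ = (−3 − I − 3J + K)/2 =
(−3 + 3i − j + ij)/2 = v₃·μ` with `v₃ = (−3 + i + j + ij)/2`; `w₃′ = (3 + I − 3J + K)/2 = (3 + 3i + j + ij)/2 = v₃′·μ` with `v₃′ = (1 +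
3i + j − ij)/2`; `w₆ = −3J + K = 3i + ij = S₂ = v₆·(1 + i)μ` with `v₆ = (1 + 3i + j + ij)/2`; the cofactors `−i, v₃, v₃′, v₆` lie in
`O₆` and have norm `1`; `w₂w₃ = w₆`; norms `2, 3, 3, 6`. [cite: BayerTravesa2007, §2 p. 319 («`w₂ := 1 + J`, `w₃ := (−3 − I − 3J + K)/2`, `w₃′ := (3 + I − 3J + K)/2`, and `w₆ := w₂w₃ = −3J + K`»)] -/
theorem bt_elements :
    ((⟨1, -1, 0, 0⟩ : ℍ[ℚ,((-1 : ℤ) : ℚ),((3 : ℤ) : ℚ)]) = ⟨0, -1, 0, 0⟩ * ⟨1, 1, 0, 0⟩ ∧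
      ((⟨1, -1, 0, 0⟩ : ℍ[ℚ,((-1 : ℤ) : ℚ),((3 : ℤ) : ℚ)]) * star ⟨1, -1, 0, 0⟩).re = 2) ∧
    ((⟨-3/2, 3/2, -1/2, 1/2⟩ : ℍ[ℚ,((-1 : ℤ) : ℚ),((3 : ℤ) : ℚ)]) = ⟨-3/2, 1/2, 1/2, 1/2⟩ * ⟨3, 0, 1, 1⟩ ∧
      ((⟨-3/2, 1/2, 1/2, 1/2⟩ : ℍ[ℚ,((-1 : ℤ) : ℚ),((3 : ℤ) : ℚ)]) - ⟨1/2, 1/2, 1/2, -1/2⟩ ∈ order (-1) 3) ∧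
      ((⟨-3/2, 1/2, 1/2, 1/2⟩ : ℍ[ℚ,((-1 : ℤ) : ℚ),((3 : ℤ) : ℚ)]) * star ⟨-3/2, 1/2, 1/2, 1/2⟩).re = 1 ∧
      ((⟨-3/2, 3/2, -1/2, 1/2⟩ : ℍ[ℚ,((-1 : ℤ) : ℚ),((3 : ℤ) : ℚ)]) * star ⟨-3/2, 3/2, -1/2, 1/2⟩).re = 3) ∧
    ((⟨3/2, 3/2, 1/2, 1/2⟩ : ℍ[ℚ,((-1 : ℤ) : ℚ),((3 : ℤ) : ℚ)]) = ⟨1/2, 3/2, 1/2, -1/2⟩ * ⟨3, 0, 1, 1⟩ ∧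
      ((⟨1/2, 3/2, 1/2, -1/2⟩ : ℍ[ℚ,((-1 : ℤ) : ℚ),((3 : ℤ) : ℚ)]) - ⟨1/2, 1/2, 1/2, -1/2⟩ ∈ order (-1) 3) ∧
      ((⟨1/2, 3/2, 1/2, -1/2⟩ : ℍ[ℚ,((-1 : ℤ) : ℚ),((3 : ℤ) : ℚ)]) * star ⟨1/2, 3/2, 1/2, -1/2⟩).re = 1 ∧
      ((⟨3/2, 3/2, 1/2, 1/2⟩ : ℍ[ℚ,((-1 : ℤ) : ℚ),((3 : ℤ) : ℚ)]) * star ⟨3/2, 3/2, 1/2, 1/2⟩).re = 3) ∧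
    ((⟨0, 3, 0, 1⟩ : ℍ[ℚ,((-1 : ℤ) : ℚ),((3 : ℤ) : ℚ)]) = ⟨1/2, 3/2, 1/2, 1/2⟩ * (⟨1, 1, 0, 0⟩ * ⟨3, 0, 1, 1⟩) ∧
      ((⟨1/2, 3/2, 1/2, 1/2⟩ : ℍ[ℚ,((-1 : ℤ) : ℚ),((3 : ℤ) : ℚ)]) - ⟨1/2, 1/2, 1/2, -1/2⟩ ∈ order (-1) 3) ∧
      ((⟨1/2, 3/2, 1/2, 1/2⟩ : ℍ[ℚ,((-1 : ℤ) : ℚ),((3 : ℤ) : ℚ)]) * star ⟨1/2, 3/2, 1/2, 1/2⟩).re = 1 ∧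
      ((⟨0, 3, 0, 1⟩ : ℍ[ℚ,((-1 : ℤ) : ℚ),((3 : ℤ) : ℚ)]) * star ⟨0, 3, 0, 1⟩).re = 6) ∧
    (⟨1, -1, 0, 0⟩ : ℍ[ℚ,((-1 : ℤ) : ℚ),((3 : ℤ) : ℚ)]) * ⟨-3/2, 3/2, -1/2, 1/2⟩ = ⟨0, 3, 0, 1⟩ := by
  refine ⟨⟨?_, ?_⟩, ⟨?_, by
      rw [show (⟨-3/2, 1/2, 1/2, 1/2⟩ : ℍ[ℚ,((-1 : ℤ) : ℚ),((3 : ℤ) : ℚ)]) - ⟨1/2, 1/2, 1/2, -1/2⟩ = ⟨-2, 0, 0, 1⟩ by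
        rw [QuaternionAlgebra.mk_sub_mk]; ext <;> norm_num]
      exact ⟨![-2, 0, 0, 1], by ext <;> simp [ofCoords]⟩, ?_, ?_⟩,
    ⟨?_, by
      rw [show (⟨1/2, 3/2, 1/2, -1/2⟩ : ℍ[ℚ,((-1 : ℤ) : ℚ),((3 : ℤ) : ℚ)]) - ⟨1/2, 1/2, 1/2, -1/2⟩ = ⟨0, 1, 0, 0⟩ by
        rw [QuaternionAlgebra.mk_sub_mk]; ext <;> norm_num]
      exact ⟨![0, 1, 0, 0], by ext <;> simp [ofCoords]⟩, ?_, ?_⟩,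
    ⟨?_, by
      rw [show (⟨1/2, 3/2, 1/2, 1/2⟩ : ℍ[ℚ,((-1 : ℤ) : ℚ),((3 : ℤ) : ℚ)]) - ⟨1/2, 1/2, 1/2, -1/2⟩ = ⟨0, 1, 0, 1⟩ by
        rw [QuaternionAlgebra.mk_sub_mk]; ext <;> norm_num]
      exact ⟨![0, 1, 0, 1], by ext <;> simp [ofCoords]⟩, ?_, ?_⟩, ?_⟩
  all_goals first
    | (rewrite [QuaternionAlgebra.mk_mul_mk]; ext <;> norm_num)
    | (rw [QuaternionAlgebra.star_mk, QuaternionAlgebra.mk_mul_mk]; norm_num)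

/-- **`{g ∈ O₆ : nr g = 2} = Γ₆·(1 + i)`**: an element of `O₆` of norm `2` is `v(1 + i)` with `v ∈ O₆¹`, and conversely — so the
norm-`2` elements of `O₆` form exactly the coset `Γ₆w₂` defining `ω₂` (from `P₂ = O₆(1 + i)`, g31-#3). [cite: BayerTravesa2007, §2 p. 318 («Its classes are represented by elements `w_d ∈ O₆` of norm `d` dividing `D = 6`»)] [cite: Ogg1983RealPoints, §2 p. 283 («`I(m) = μ𝒪 = 𝒪μ`»)] -/
theorem norm_two_iff_coset (g : ℍ[ℚ,((-1 : ℤ) : ℚ),((3 : ℤ) : ℚ)]) :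
    ((g ∈ order (-1) 3 ∨ g - ⟨1/2, 1/2, 1/2, -1/2⟩ ∈ order (-1) 3) ∧ (g * star g).re = 2) ↔
      ∃ v : ℍ[ℚ,((-1 : ℤ) : ℚ),((3 : ℤ) : ℚ)], (v ∈ order (-1) 3 ∨ v - ⟨1/2, 1/2, 1/2, -1/2⟩ ∈ order (-1) 3) ∧
        (v * star v).re = 1 ∧ g = v * ⟨1, 1, 0, 0⟩ := by
  have hw : ((⟨1, 1, 0, 0⟩ : ℍ[ℚ,((-1 : ℤ) : ℚ),((3 : ℤ) : ℚ)]) * star ⟨1, 1, 0, 0⟩).re = 2 := by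
    rw [QuaternionAlgebra.star_mk, QuaternionAlgebra.mk_mul_mk]; norm_num
  constructor
  · rintro ⟨hg, hn⟩
    obtain ⟨v, hv, rfl⟩ := (primeTwo_iff_exists_mul_one_add_i _).1 ⟨hg, 1, by rw [hn]; norm_num⟩
    refine ⟨v, hv, ?_, rfl⟩
    have h := re_mul_mul_star_mul v (⟨1, 1, 0, 0⟩ : ℍ[ℚ,((-1 : ℤ) : ℚ),((3 : ℤ) : ℚ)])
    rw [hn, hw] at h
    linarith
  · rintro ⟨v, hv, hvn, rfl⟩
    exact ⟨maxOrder_mul hv (Or.inl ⟨![1, 1, 0, 0], by ext <;> simp [ofCoords]⟩), by rw [re_mul_mul_star_mul, hvn, hw, one_mul]⟩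

/-- **`{g ∈ O₆ : nr g = 3} = Γ₆·μ`**, `μ = 3 + j + ij` (from `P₃ = O₆μ`, g31-#3): the coset `Γ₆w₃`. [cite: BayerTravesa2007, §2 p. 318] [cite: Ogg1983RealPoints, §2 p. 283] -/
theorem norm_three_iff_coset (g : ℍ[ℚ,((-1 : ℤ) : ℚ),((3 : ℤ) : ℚ)]) :
    ((g ∈ order (-1) 3 ∨ g - ⟨1/2, 1/2, 1/2, -1/2⟩ ∈ order (-1) 3) ∧ (g * star g).re = 3) ↔
      ∃ v : ℍ[ℚ,((-1 : ℤ) : ℚ),((3 : ℤ) : ℚ)], (v ∈ order (-1) 3 ∨ v - ⟨1/2, 1/2, 1/2, -1/2⟩ ∈ order (-1) 3) ∧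
        (v * star v).re = 1 ∧ g = v * ⟨3, 0, 1, 1⟩ := by
  have hw : ((⟨3, 0, 1, 1⟩ : ℍ[ℚ,((-1 : ℤ) : ℚ),((3 : ℤ) : ℚ)]) * star ⟨3, 0, 1, 1⟩).re = 3 := by
    rw [QuaternionAlgebra.star_mk, QuaternionAlgebra.mk_mul_mk]; norm_num
  constructor
  · rintro ⟨hg, hn⟩
    obtain ⟨v, hv, rfl⟩ := (primeThree_iff_exists_mul_mu _).1 ⟨hg, 1, by rw [hn]; norm_num⟩
    refine ⟨v, hv, ?_, rfl⟩
    have h := re_mul_mul_star_mul v (⟨3, 0, 1, 1⟩ : ℍ[ℚ,((-1 : ℤ) : ℚ),((3 : ℤ) : ℚ)])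
    rw [hn, hw] at h
    linarith
  · rintro ⟨v, hv, hvn, rfl⟩
    exact ⟨maxOrder_mul hv (Or.inl ⟨![3, 0, 1, 1], by ext <;> simp [ofCoords]⟩), by rw [re_mul_mul_star_mul, hvn, hw, one_mul]⟩

/-- **`{g ∈ O₆ : nr g = 6} = Γ₆·w₆`**, `w₆ = (1 + i)μ = 3 + 3i + 2ij` (from `P₂ ∩ P₃ = O₆w₆`, g31-#6): the coset `Γ₆w₆`.
[cite: BayerTravesa2007, §2 p. 318] [cite: Ogg1983RealPoints, §2 p. 283] -/
theorem norm_six_iff_coset (g : ℍ[ℚ,((-1 : ℤ) : ℚ),((3 : ℤ) : ℚ)]) :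
    ((g ∈ order (-1) 3 ∨ g - ⟨1/2, 1/2, 1/2, -1/2⟩ ∈ order (-1) 3) ∧ (g * star g).re = 6) ↔
      ∃ v : ℍ[ℚ,((-1 : ℤ) : ℚ),((3 : ℤ) : ℚ)], (v ∈ order (-1) 3 ∨ v - ⟨1/2, 1/2, 1/2, -1/2⟩ ∈ order (-1) 3) ∧
        (v * star v).re = 1 ∧ g = v * ⟨3, 3, 0, 2⟩ := by
  obtain ⟨-, hw, hwo⟩ := one_add_i_mul_mu
  constructor
  · rintro ⟨hg, hn⟩
    obtain ⟨v, hv, rfl⟩ := (primeSix_iff_exists_mul_w6 _).1 ⟨hg, 1, by rw [hn]; norm_num⟩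
    refine ⟨v, hv, ?_, rfl⟩
    have h := re_mul_mul_star_mul v (⟨3, 3, 0, 2⟩ : ℍ[ℚ,((-1 : ℤ) : ℚ),((3 : ℤ) : ℚ)])
    rw [hn, hw] at h
    linarith
  · rintro ⟨v, hv, hvn, rfl⟩
    exact ⟨maxOrder_mul hv (Or.inl hwo), by rw [re_mul_mul_star_mul, hvn, hw, one_mul]⟩

/-- **EVERY ELEMENT OF `O₆` OF NORM `2, 3` OR `6` NORMALISES `O₆`** — it is `v(1 + i)ᵏμˡ` with `v ∈ O₆¹` (§1 cosets), which
normalises `𝔬` (g31-#1 `normalises_maxOrder_unit_mul_atkinLehner`), and `N(𝔬) ⊆ N(O₆)` (`maxOrder_normalises_of_order_normalises`).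
So the elements `g` of the table below are genuine Atkin–Lehner elements: `g ∈ N(O₆)`, `nr g = d ∣ 6`. [cite: BayerTravesa2007, §2 p. 318 («The elements of `N(O₆)` of positive reduced norm define a subgroup … `Γ₆⁺`»)] [cite: Ogg1983RealPoints, §2 p. 283 («`𝒪 = μ𝒪μ⁻¹`»)] -/
theorem normalises_maxOrder_of_norm {g : ℍ[ℚ,((-1 : ℤ) : ℚ),((3 : ℤ) : ℚ)]}
    (hg : g ∈ order (-1) 3 ∨ g - ⟨1/2, 1/2, 1/2, -1/2⟩ ∈ order (-1) 3)
    (hn : (g * star g).re = 2 ∨ (g * star g).re = 3 ∨ (g * star g).re = 6) :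
    (∀ x, (x ∈ order (-1) 3 ∨ x - ⟨1/2, 1/2, 1/2, -1/2⟩ ∈ order (-1) 3) →
        ∃ y, (y ∈ order (-1) 3 ∨ y - ⟨1/2, 1/2, 1/2, -1/2⟩ ∈ order (-1) 3) ∧ g * x = y * g) ∧
      (∀ y, (y ∈ order (-1) 3 ∨ y - ⟨1/2, 1/2, 1/2, -1/2⟩ ∈ order (-1) 3) →
        ∃ x, (x ∈ order (-1) 3 ∨ x - ⟨1/2, 1/2, 1/2, -1/2⟩ ∈ order (-1) 3) ∧ y * g = g * x) := by
  have hg0 : g ≠ 0 := by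
    rintro rfl
    simp only [zero_mul, QuaternionAlgebra.re_zero] at hn
    norm_num at hn
  apply maxOrder_normalises_of_order_normalises hg0
  obtain ⟨hw6, -, -⟩ := one_add_i_mul_mu
  rcases hn with hn | hn | hn
  · obtain ⟨v, hv, hvn, rfl⟩ := (norm_two_iff_coset g).1 ⟨hg, hn⟩
    have h := normalises_maxOrder_unit_mul_atkinLehner hv (Or.inl (mul_star_eq_one_of_re hvn)) 1 0
    simpa only [pow_one, pow_zero, mul_one] using h
  · obtain ⟨v, hv, hvn, rfl⟩ := (norm_three_iff_coset g).1 ⟨hg, hn⟩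
    have h := normalises_maxOrder_unit_mul_atkinLehner hv (Or.inl (mul_star_eq_one_of_re hvn)) 0 1
    simpa only [pow_one, pow_zero, mul_one] using h
  · obtain ⟨v, hv, hvn, rfl⟩ := (norm_six_iff_coset g).1 ⟨hg, hn⟩
    have h := normalises_maxOrder_unit_mul_atkinLehner hv (Or.inl (mul_star_eq_one_of_re hvn)) 1 1
    rw [← hw6, ← mul_assoc]
    simpa only [pow_one] using h

/-- **`ω_d² = 1` ON `X₆`: `(1 + i)² = 2·i`, `μ² = 3·(5 + 2j + 2ij)`, `w₆² = 6·(2 + 3i + 2ij)` with `i`, `5 + 2j + 2ij`, `2 + 3i + 2ij ∈ 𝔬`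
of norm `1`** — each `w_d²` lies in `ℚ^×Γ₆`. [cite: BayerTravesa2007, §2 p. 318 («They give rise to involutions of the curve `X₆`, denoted `ω_d`»)] [cite: Ogg1983RealPoints, §2 p. 283 («`w(m)² = 1`»)] -/
theorem atkinLehner_sq :
    ((⟨1, 1, 0, 0⟩ : ℍ[ℚ,((-1 : ℤ) : ℚ),((3 : ℤ) : ℚ)]) * ⟨1, 1, 0, 0⟩ = (2 : ℚ) • ⟨0, 1, 0, 0⟩ ∧
      ((⟨0, 1, 0, 0⟩ : ℍ[ℚ,((-1 : ℤ) : ℚ),((3 : ℤ) : ℚ)]) * star ⟨0, 1, 0, 0⟩).re = 1) ∧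
    ((⟨3, 0, 1, 1⟩ : ℍ[ℚ,((-1 : ℤ) : ℚ),((3 : ℤ) : ℚ)]) * ⟨3, 0, 1, 1⟩ = (3 : ℚ) • ⟨5, 0, 2, 2⟩ ∧
      ((⟨5, 0, 2, 2⟩ : ℍ[ℚ,((-1 : ℤ) : ℚ),((3 : ℤ) : ℚ)]) * star ⟨5, 0, 2, 2⟩).re = 1 ∧
      (⟨5, 0, 2, 2⟩ : ℍ[ℚ,((-1 : ℤ) : ℚ),((3 : ℤ) : ℚ)]) ∈ order (-1) 3) ∧
    ((⟨3, 3, 0, 2⟩ : ℍ[ℚ,((-1 : ℤ) : ℚ),((3 : ℤ) : ℚ)]) * ⟨3, 3, 0, 2⟩ = (6 : ℚ) • ⟨2, 3, 0, 2⟩ ∧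
      ((⟨2, 3, 0, 2⟩ : ℍ[ℚ,((-1 : ℤ) : ℚ),((3 : ℤ) : ℚ)]) * star ⟨2, 3, 0, 2⟩).re = 1 ∧
      (⟨2, 3, 0, 2⟩ : ℍ[ℚ,((-1 : ℤ) : ℚ),((3 : ℤ) : ℚ)]) ∈ order (-1) 3) := by
  refine ⟨⟨?_, ?_⟩, ⟨?_, ?_, ⟨![5, 0, 2, 2], by ext <;> simp [ofCoords]⟩⟩, ⟨?_, ?_, ⟨![2, 3, 0, 2], by ext <;> simp [ofCoords]⟩⟩⟩
  all_goals first
    | (rw [QuaternionAlgebra.mk_mul_mk, ratSmul_mk]; ext <;> norm_num)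
    | (rw [QuaternionAlgebra.star_mk, QuaternionAlgebra.mk_mul_mk]; norm_num)

/-! ## §2 Obstructions: anticommuting forces non-positive norm; commuting lands in `ℚ(x)` -/

/-- **A `g ∈ B` ANTICOMMUTING WITH A SPECIAL VECTOR HAS `nr g ≤ 0`**: `gx = −xg` for `x = x₁i + x₂j + x₃ij` with `Q(x) = x₁² −
3x₂² − 3x₃² > 0` forces `g₀ = 0` and `g⃗ ⊥ x` for the form `Q`, and `x^⊥` is negative definite (signature `(1, 2)`):
`x₁²·Q(g⃗) + 3(g₂² + g₃²)·Q(x) + 9(g₂x₃ − g₃x₂)² = 0`. Hence NO element of positive norm — no unit of `Γ₆`, no Atkin–Lehner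
element — reverses a special vector: on points, `ω_d(P_x) = P_x` can only come from `gxg⁻¹ ∈ Γ₆·x`, never from `−x` (the
mechanism of KRY's Lemma 3.4.3). [cite: KudlaRapoportYang2006, §3.4 Lemma 3.4.3 (i)–(ii) («`γ` reverses the orientation on `U(w(z₀))` and hence acts by `−1` on `x`, which is excluded by (i)»)] -/
theorem norm_nonpos_of_anticommute {g : ℍ[ℚ,((-1 : ℤ) : ℚ),((3 : ℤ) : ℚ)]} {x₁ x₂ x₃ : ℚ}
    (hx : 0 < x₁ ^ 2 - 3 * x₂ ^ 2 - 3 * x₃ ^ 2) (h : g * ⟨0, x₁, x₂, x₃⟩ = -(⟨0, x₁, x₂, x₃⟩ * g)) :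
    (g * star g).re ≤ 0 := by
  obtain ⟨g₀, g₁, g₂, g₃⟩ := g
  rw [QuaternionAlgebra.mk_mul_mk, QuaternionAlgebra.mk_mul_mk, QuaternionAlgebra.neg_mk] at h
  have h0 := congrArg QuaternionAlgebra.re h
  have h1 := congrArg QuaternionAlgebra.imI h
  have h2 := congrArg QuaternionAlgebra.imJ h
  have h3 := congrArg QuaternionAlgebra.imK h
  simp only at h0 h1 h2 h3
  push_cast at h0 h1 h2 h3
  -- scalar part: `B(g⃗, x) = g₁x₁ − 3g₂x₂ − 3g₃x₃ = 0`; vector part: `g₀ = 0` (as `x ≠ 0`).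
  have hB : g₁ * x₁ - 3 * g₂ * x₂ - 3 * g₃ * x₃ = 0 := by linarith
  have hx1 : 0 < x₁ ^ 2 := by nlinarith [sq_nonneg x₂, sq_nonneg x₃]
  have hg0 : g₀ = 0 := by
    have e1 : g₀ * x₁ = 0 := by linarith
    rcases mul_eq_zero.1 e1 with h | h
    · exact h
    · exfalso; rw [h] at hx1; simp at hx1
  have key : x₁ ^ 2 * (g₁ ^ 2 - 3 * g₂ ^ 2 - 3 * g₃ ^ 2) + 3 * (g₂ ^ 2 + g₃ ^ 2) * (x₁ ^ 2 - 3 * x₂ ^ 2 - 3 * x₃ ^ 2) +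
      9 * (g₂ * x₃ - g₃ * x₂) ^ 2 = 0 := by
    linear_combination (x₁ * g₁ + 3 * (g₂ * x₂ + g₃ * x₃)) * hB
  rw [QuaternionAlgebra.star_mk, QuaternionAlgebra.mk_mul_mk]
  push_cast
  rw [hg0]
  have hQg : g₁ ^ 2 - 3 * g₂ ^ 2 - 3 * g₃ ^ 2 ≤ 0 := by
    by_contra hc
    push Not at hc
    nlinarith [sq_nonneg (g₂ * x₃ - g₃ * x₂), sq_nonneg g₂, sq_nonneg g₃, mul_pos hx1 hc]
  nlinarith [hQg]

/-- `n² + 6m² ∉ {8, 12}`, `n² + m² ∉ {12, 24}`, `n² + 3m² ∉ {8, 24}` for integers — the integrality obstructions of §4. [folklore] -/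
private theorem sq_forms_ne {n m : ℤ} :
    (n ^ 2 + 6 * m ^ 2 ≠ 8 ∧ n ^ 2 + 6 * m ^ 2 ≠ 12) ∧ (n ^ 2 + m ^ 2 ≠ 12 ∧ n ^ 2 + m ^ 2 ≠ 24) ∧
    (n ^ 2 + 3 * m ^ 2 ≠ 8 ∧ n ^ 2 + 3 * m ^ 2 ≠ 24) := by
  refine ⟨⟨fun h ↦ ?_, fun h ↦ ?_⟩, ⟨fun h ↦ ?_, fun h ↦ ?_⟩, ⟨fun h ↦ ?_, fun h ↦ ?_⟩⟩
  all_goals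
    have h1 : m ≤ 4 := by nlinarith
    have h2 : -4 ≤ m := by nlinarith
    have h3 : n ≤ 4 := by nlinarith
    have h4 : -4 ≤ n := by nlinarith
    interval_cases m <;> interval_cases n <;> omega

/-! ## §3 The permutation table -/

/-- **`ω₂` ON THE SPECIAL POINTS**: explicit `g ∈ 𝔬 ⊂ O₆` of norm `2` with `g·i = i·g` (`g = 1 + i`), `g·E = E·g` (`g = 1 + 2i − ij`),
`g·R₁ = R₂·g` (`g = 1 − i`), `g·R₂ = R₁·g` (`g = 1 + i`), `g·S₁ = S₂·g` (`g = 1 + i`), `g·S₂ = S₁·g` (`g = 1 − i = w₂`) — **`ω₂` FIXES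
the two order-`2` points `P₆ = z_i`, `P₁₃₅ = z_E`, SWAPS the order-`3` points `P₄ = z_{R₁} ↔ P₂ = z_{R₂}` and the SCM points
`P₇ = z_{S₁} ↔ P₀ = z_{S₂}`**: Bayer–Travesa's `ω₂[P₁, P₂, P₆] = [P₃, P₄, P₆]`. [cite: BayerTravesa2007, §2 p. 319 («`ω₂[P₁, P₂, P₆] = [P₃, P₄, P₆]`, `ω₂[P₂, P₃, P₆] = [P₄, P₅, P₆]`»)] [cite: KudlaRapoportYang2006, §3.4 Remark 3.4.7] -/
theorem omega_two_table :
    ((⟨1, 1, 0, 0⟩ : ℍ[ℚ,((-1 : ℤ) : ℚ),((3 : ℤ) : ℚ)]) * ⟨0, 1, 0, 0⟩ = ⟨0, 1, 0, 0⟩ * ⟨1, 1, 0, 0⟩ ∧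
      ((⟨1, 1, 0, 0⟩ : ℍ[ℚ,((-1 : ℤ) : ℚ),((3 : ℤ) : ℚ)]) * star ⟨1, 1, 0, 0⟩).re = 2 ∧
      (⟨1, 1, 0, 0⟩ : ℍ[ℚ,((-1 : ℤ) : ℚ),((3 : ℤ) : ℚ)]) ∈ order (-1) 3) ∧
    ((⟨1, 2, 0, -1⟩ : ℍ[ℚ,((-1 : ℤ) : ℚ),((3 : ℤ) : ℚ)]) * ⟨0, -2, 0, 1⟩ = ⟨0, -2, 0, 1⟩ * ⟨1, 2, 0, -1⟩ ∧
      ((⟨1, 2, 0, -1⟩ : ℍ[ℚ,((-1 : ℤ) : ℚ),((3 : ℤ) : ℚ)]) * star ⟨1, 2, 0, -1⟩).re = 2 ∧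
      (⟨1, 2, 0, -1⟩ : ℍ[ℚ,((-1 : ℤ) : ℚ),((3 : ℤ) : ℚ)]) ∈ order (-1) 3) ∧
    ((⟨1, -1, 0, 0⟩ : ℍ[ℚ,((-1 : ℤ) : ℚ),((3 : ℤ) : ℚ)]) * ⟨0, 3, 1, 1⟩ = ⟨0, 3, 1, -1⟩ * ⟨1, -1, 0, 0⟩ ∧
      (⟨1, 1, 0, 0⟩ : ℍ[ℚ,((-1 : ℤ) : ℚ),((3 : ℤ) : ℚ)]) * ⟨0, 3, 1, -1⟩ = ⟨0, 3, 1, 1⟩ * ⟨1, 1, 0, 0⟩ ∧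
      ((⟨1, -1, 0, 0⟩ : ℍ[ℚ,((-1 : ℤ) : ℚ),((3 : ℤ) : ℚ)]) * star ⟨1, -1, 0, 0⟩).re = 2 ∧
      (⟨1, -1, 0, 0⟩ : ℍ[ℚ,((-1 : ℤ) : ℚ),((3 : ℤ) : ℚ)]) ∈ order (-1) 3) ∧
    ((⟨1, 1, 0, 0⟩ : ℍ[ℚ,((-1 : ℤ) : ℚ),((3 : ℤ) : ℚ)]) * ⟨0, 3, 1, 0⟩ = ⟨0, 3, 0, 1⟩ * ⟨1, 1, 0, 0⟩ ∧
      (⟨1, -1, 0, 0⟩ : ℍ[ℚ,((-1 : ℤ) : ℚ),((3 : ℤ) : ℚ)]) * ⟨0, 3, 0, 1⟩ = ⟨0, 3, 1, 0⟩ * ⟨1, -1, 0, 0⟩) := by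
  refine ⟨⟨?_, ?_, ⟨![1, 1, 0, 0], by ext <;> simp [ofCoords]⟩⟩, ⟨?_, ?_, ⟨![1, 2, 0, -1], by ext <;> simp [ofCoords]⟩⟩,
    ⟨?_, ?_, ?_, ⟨![1, -1, 0, 0], by ext <;> simp [ofCoords]⟩⟩, ⟨?_, ?_⟩⟩
  all_goals first
    | (rw [QuaternionAlgebra.mk_mul_mk, QuaternionAlgebra.mk_mul_mk]; ext <;> norm_num)
    | (rw [QuaternionAlgebra.star_mk, QuaternionAlgebra.mk_mul_mk]; norm_num)

/-- **`ω₃` ON THE SPECIAL POINTS**: explicit `g ∈ O₆` of norm `3`: `g·i = (−E)·g` and `g·R₂ = R₂·g` for `g = (3 + 3i + j − ij)/2`,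
`g·E = (−i)·g` for `g = (3 + 3i − j − ij)/2`, `g·R₁ = R₁·g` and `g·S₂ = S₁·g` for `g = (3 + 3i + j + ij)/2 = w₃′`, `g·S₁ = S₂·g` for
`g = (3 − 3i − j − ij)/2` — **`ω₃` SWAPS the order-`2` points `P₆ ↔ P₁₃₅` (`z_i ↦ z_{−E} = z_E`'s pair), FIXES the order-`3` points
`P₄`, `P₂`, SWAPS the SCM points `P₇ ↔ P₀`**: Bayer–Travesa's `ω₃[P₂, P₃, P₆] = [P₂, P₆, P₁]`, `ω₃′[P₃, P₄, P₆] = [P₆, P₄, P₅]`.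
[cite: BayerTravesa2007, §2 p. 319 («`ω₃[P₂, P₃, P₆] = [P₂, P₆, P₁]`, `ω₃′[P₃, P₄, P₆] = [P₆, P₄, P₅]`»)] [cite: KudlaRapoportYang2006, §3.4 Remark 3.4.7] -/
theorem omega_three_table :
    ((⟨3/2, 3/2, 1/2, -1/2⟩ : ℍ[ℚ,((-1 : ℤ) : ℚ),((3 : ℤ) : ℚ)]) * ⟨0, 1, 0, 0⟩ = ⟨0, 2, 0, -1⟩ * ⟨3/2, 3/2, 1/2, -1/2⟩ ∧
      (⟨3/2, 3/2, 1/2, -1/2⟩ : ℍ[ℚ,((-1 : ℤ) : ℚ),((3 : ℤ) : ℚ)]) * ⟨0, 3, 1, -1⟩ = ⟨0, 3, 1, -1⟩ * ⟨3/2, 3/2, 1/2, -1/2⟩ ∧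
      ((⟨3/2, 3/2, 1/2, -1/2⟩ : ℍ[ℚ,((-1 : ℤ) : ℚ),((3 : ℤ) : ℚ)]) * star ⟨3/2, 3/2, 1/2, -1/2⟩).re = 3 ∧
      (⟨3/2, 3/2, 1/2, -1/2⟩ : ℍ[ℚ,((-1 : ℤ) : ℚ),((3 : ℤ) : ℚ)]) - ⟨1/2, 1/2, 1/2, -1/2⟩ ∈ order (-1) 3) ∧
    ((⟨3/2, 3/2, -1/2, -1/2⟩ : ℍ[ℚ,((-1 : ℤ) : ℚ),((3 : ℤ) : ℚ)]) * ⟨0, -2, 0, 1⟩ = ⟨0, -1, 0, 0⟩ * ⟨3/2, 3/2, -1/2, -1/2⟩ ∧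
      ((⟨3/2, 3/2, -1/2, -1/2⟩ : ℍ[ℚ,((-1 : ℤ) : ℚ),((3 : ℤ) : ℚ)]) * star ⟨3/2, 3/2, -1/2, -1/2⟩).re = 3 ∧
      (⟨3/2, 3/2, -1/2, -1/2⟩ : ℍ[ℚ,((-1 : ℤ) : ℚ),((3 : ℤ) : ℚ)]) - ⟨1/2, 1/2, 1/2, -1/2⟩ ∈ order (-1) 3) ∧
    ((⟨3/2, 3/2, 1/2, 1/2⟩ : ℍ[ℚ,((-1 : ℤ) : ℚ),((3 : ℤ) : ℚ)]) * ⟨0, 3, 1, 1⟩ = ⟨0, 3, 1, 1⟩ * ⟨3/2, 3/2, 1/2, 1/2⟩ ∧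
      (⟨3/2, 3/2, 1/2, 1/2⟩ : ℍ[ℚ,((-1 : ℤ) : ℚ),((3 : ℤ) : ℚ)]) * ⟨0, 3, 0, 1⟩ = ⟨0, 3, 1, 0⟩ * ⟨3/2, 3/2, 1/2, 1/2⟩ ∧
      ((⟨3/2, 3/2, 1/2, 1/2⟩ : ℍ[ℚ,((-1 : ℤ) : ℚ),((3 : ℤ) : ℚ)]) * star ⟨3/2, 3/2, 1/2, 1/2⟩).re = 3 ∧
      (⟨3/2, 3/2, 1/2, 1/2⟩ : ℍ[ℚ,((-1 : ℤ) : ℚ),((3 : ℤ) : ℚ)]) - ⟨1/2, 1/2, 1/2, -1/2⟩ ∈ order (-1) 3) ∧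
    ((⟨3/2, -3/2, -1/2, -1/2⟩ : ℍ[ℚ,((-1 : ℤ) : ℚ),((3 : ℤ) : ℚ)]) * ⟨0, 3, 1, 0⟩ = ⟨0, 3, 0, 1⟩ * ⟨3/2, -3/2, -1/2, -1/2⟩ ∧
      ((⟨3/2, -3/2, -1/2, -1/2⟩ : ℍ[ℚ,((-1 : ℤ) : ℚ),((3 : ℤ) : ℚ)]) * star ⟨3/2, -3/2, -1/2, -1/2⟩).re = 3 ∧
      (⟨3/2, -3/2, -1/2, -1/2⟩ : ℍ[ℚ,((-1 : ℤ) : ℚ),((3 : ℤ) : ℚ)]) - ⟨1/2, 1/2, 1/2, -1/2⟩ ∈ order (-1) 3) := by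
  refine ⟨⟨?_, ?_, ?_, by
      rw [show (⟨3/2, 3/2, 1/2, -1/2⟩ : ℍ[ℚ,((-1 : ℤ) : ℚ),((3 : ℤ) : ℚ)]) - ⟨1/2, 1/2, 1/2, -1/2⟩ = ⟨1, 1, 0, 0⟩ by
        rw [QuaternionAlgebra.mk_sub_mk]; ext <;> norm_num]
      exact ⟨![1, 1, 0, 0], by ext <;> simp [ofCoords]⟩⟩,
    ⟨?_, ?_, by
      rw [show (⟨3/2, 3/2, -1/2, -1/2⟩ : ℍ[ℚ,((-1 : ℤ) : ℚ),((3 : ℤ) : ℚ)]) - ⟨1/2, 1/2, 1/2, -1/2⟩ = ⟨1, 1, -1, 0⟩ by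
        rw [QuaternionAlgebra.mk_sub_mk]; ext <;> norm_num]
      exact ⟨![1, 1, -1, 0], by ext <;> simp [ofCoords]⟩⟩,
    ⟨?_, ?_, ?_, by
      rw [show (⟨3/2, 3/2, 1/2, 1/2⟩ : ℍ[ℚ,((-1 : ℤ) : ℚ),((3 : ℤ) : ℚ)]) - ⟨1/2, 1/2, 1/2, -1/2⟩ = ⟨1, 1, 0, 1⟩ by
        rw [QuaternionAlgebra.mk_sub_mk]; ext <;> norm_num]
      exact ⟨![1, 1, 0, 1], by ext <;> simp [ofCoords]⟩⟩,
    ⟨?_, ?_, by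
      rw [show (⟨3/2, -3/2, -1/2, -1/2⟩ : ℍ[ℚ,((-1 : ℤ) : ℚ),((3 : ℤ) : ℚ)]) - ⟨1/2, 1/2, 1/2, -1/2⟩ = ⟨1, -2, -1, 0⟩ by
        rw [QuaternionAlgebra.mk_sub_mk]; ext <;> norm_num]
      exact ⟨![1, -2, -1, 0], by ext <;> simp [ofCoords]⟩⟩⟩
  all_goals first
    | (rw [QuaternionAlgebra.mk_mul_mk, QuaternionAlgebra.mk_mul_mk]; ext <;> norm_num)
    | (rw [QuaternionAlgebra.star_mk, QuaternionAlgebra.mk_mul_mk]; norm_num)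

/-- **`ω₆` ON THE SPECIAL POINTS**: explicit `g ∈ 𝔬 ⊂ O₆` of norm `6`: `g·i = (−E)·g` and `g·R₁ = R₂·g` for `g = 3 + j`, `g·E = (−i)·g`
and `g·R₂ = R₁·g` for `g = 3 − j`, and the SCM vectors are their OWN Atkin–Lehner elements: `S₁·S₁ = S₁·S₁`, `S₂·S₂ = S₂·S₂`
with `nr S₁ = nr S₂ = 6` (`S₂ = w₆` literally) — **`ω₆` SWAPS `P₆ ↔ P₁₃₅` and `P₄ ↔ P₂`, and FIXES BOTH SCM points `P₇`, `P₀`**: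
Bayer–Travesa's `ω₆[P₂, P₃, P₆] = [P₄, P₆, P₃]` and `ω₆[P₀, P₃] = [P₀, P₆]`. [cite: BayerTravesa2007, §2 p. 319 («`ω₆[P₂, P₃, P₆] = [P₄, P₆, P₃]`») and Prop. 2.1 («`ω₆[P₀, P₃] = [P₀, P₆]`»)] [cite: KudlaRapoportYang2006, §3.4 Remark 3.4.7] -/
theorem omega_six_table :
    ((⟨3, 0, 1, 0⟩ : ℍ[ℚ,((-1 : ℤ) : ℚ),((3 : ℤ) : ℚ)]) * ⟨0, 1, 0, 0⟩ = ⟨0, 2, 0, -1⟩ * ⟨3, 0, 1, 0⟩ ∧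
      (⟨3, 0, 1, 0⟩ : ℍ[ℚ,((-1 : ℤ) : ℚ),((3 : ℤ) : ℚ)]) * ⟨0, 3, 1, 1⟩ = ⟨0, 3, 1, -1⟩ * ⟨3, 0, 1, 0⟩ ∧
      ((⟨3, 0, 1, 0⟩ : ℍ[ℚ,((-1 : ℤ) : ℚ),((3 : ℤ) : ℚ)]) * star ⟨3, 0, 1, 0⟩).re = 6 ∧
      (⟨3, 0, 1, 0⟩ : ℍ[ℚ,((-1 : ℤ) : ℚ),((3 : ℤ) : ℚ)]) ∈ order (-1) 3) ∧
    ((⟨3, 0, -1, 0⟩ : ℍ[ℚ,((-1 : ℤ) : ℚ),((3 : ℤ) : ℚ)]) * ⟨0, -2, 0, 1⟩ = ⟨0, -1, 0, 0⟩ * ⟨3, 0, -1, 0⟩ ∧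
      (⟨3, 0, -1, 0⟩ : ℍ[ℚ,((-1 : ℤ) : ℚ),((3 : ℤ) : ℚ)]) * ⟨0, 3, 1, -1⟩ = ⟨0, 3, 1, 1⟩ * ⟨3, 0, -1, 0⟩ ∧
      ((⟨3, 0, -1, 0⟩ : ℍ[ℚ,((-1 : ℤ) : ℚ),((3 : ℤ) : ℚ)]) * star ⟨3, 0, -1, 0⟩).re = 6 ∧
      (⟨3, 0, -1, 0⟩ : ℍ[ℚ,((-1 : ℤ) : ℚ),((3 : ℤ) : ℚ)]) ∈ order (-1) 3) ∧
    (((⟨0, 3, 1, 0⟩ : ℍ[ℚ,((-1 : ℤ) : ℚ),((3 : ℤ) : ℚ)]) * star ⟨0, 3, 1, 0⟩).re = 6 ∧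
      (⟨0, 3, 1, 0⟩ : ℍ[ℚ,((-1 : ℤ) : ℚ),((3 : ℤ) : ℚ)]) ∈ order (-1) 3 ∧
      ((⟨0, 3, 0, 1⟩ : ℍ[ℚ,((-1 : ℤ) : ℚ),((3 : ℤ) : ℚ)]) * star ⟨0, 3, 0, 1⟩).re = 6 ∧
      (⟨0, 3, 0, 1⟩ : ℍ[ℚ,((-1 : ℤ) : ℚ),((3 : ℤ) : ℚ)]) ∈ order (-1) 3) := by
  refine ⟨⟨?_, ?_, ?_, ⟨![3, 0, 1, 0], by ext <;> simp [ofCoords]⟩⟩, ⟨?_, ?_, ?_, ⟨![3, 0, -1, 0], by ext <;> simp [ofCoords]⟩⟩,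
    ⟨?_, ⟨![0, 3, 1, 0], by ext <;> simp [ofCoords]⟩, ?_, ⟨![0, 3, 0, 1], by ext <;> simp [ofCoords]⟩⟩⟩
  all_goals first
    | (rw [QuaternionAlgebra.mk_mul_mk, QuaternionAlgebra.mk_mul_mk]; ext <;> norm_num)
    | (rw [QuaternionAlgebra.star_mk, QuaternionAlgebra.mk_mul_mk]; norm_num)

/-- **The special vectors of `L(3)` and `L(6)` are Atkin–Lehner elements**: `R₁ = (−2 + 3i + 2j)·μ` with `−2 + 3i + 2j ∈ 𝔬¹` (so
`R₁ ∈ Γ₆w₃` fixes its own point `P₄`: `ω₃(P₄) = P₄`), and `S₁ = ((3 + 5i + 3j + ij)/2)·w₆`, `S₂ = ((1 + 3i + j + ij)/2)·w₆` with the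
cofactors in `O₆¹` (`ω₆(P₇) = P₇`, `ω₆(P₀) = P₀`). [cite: BayerTravesa2007, §2 Prop. 2.1 («`ω₆[P₀, P₃] = [P₀, P₆]`») and §7 p. 332 («`P₀` is an elliptic point for `X₆^{(6)}`»)] [cite: Ogg1983RealPoints, §2 p. 283] -/
theorem specialVectors_in_cosets :
    ((⟨0, 3, 1, 1⟩ : ℍ[ℚ,((-1 : ℤ) : ℚ),((3 : ℤ) : ℚ)]) = ⟨-2, 3, 2, 0⟩ * ⟨3, 0, 1, 1⟩ ∧
      ((⟨-2, 3, 2, 0⟩ : ℍ[ℚ,((-1 : ℤ) : ℚ),((3 : ℤ) : ℚ)]) * star ⟨-2, 3, 2, 0⟩).re = 1 ∧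
      (⟨-2, 3, 2, 0⟩ : ℍ[ℚ,((-1 : ℤ) : ℚ),((3 : ℤ) : ℚ)]) ∈ order (-1) 3) ∧
    ((⟨0, 3, 1, 0⟩ : ℍ[ℚ,((-1 : ℤ) : ℚ),((3 : ℤ) : ℚ)]) = ⟨3/2, 5/2, 3/2, 1/2⟩ * ⟨3, 3, 0, 2⟩ ∧
      ((⟨3/2, 5/2, 3/2, 1/2⟩ : ℍ[ℚ,((-1 : ℤ) : ℚ),((3 : ℤ) : ℚ)]) * star ⟨3/2, 5/2, 3/2, 1/2⟩).re = 1 ∧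
      (⟨3/2, 5/2, 3/2, 1/2⟩ : ℍ[ℚ,((-1 : ℤ) : ℚ),((3 : ℤ) : ℚ)]) - ⟨1/2, 1/2, 1/2, -1/2⟩ ∈ order (-1) 3) ∧
    ((⟨0, 3, 0, 1⟩ : ℍ[ℚ,((-1 : ℤ) : ℚ),((3 : ℤ) : ℚ)]) = ⟨1/2, 3/2, 1/2, 1/2⟩ * ⟨3, 3, 0, 2⟩ ∧
      ((⟨1/2, 3/2, 1/2, 1/2⟩ : ℍ[ℚ,((-1 : ℤ) : ℚ),((3 : ℤ) : ℚ)]) * star ⟨1/2, 3/2, 1/2, 1/2⟩).re = 1 ∧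
      (⟨1/2, 3/2, 1/2, 1/2⟩ : ℍ[ℚ,((-1 : ℤ) : ℚ),((3 : ℤ) : ℚ)]) - ⟨1/2, 1/2, 1/2, -1/2⟩ ∈ order (-1) 3) := by
  refine ⟨⟨?_, ?_, ⟨![-2, 3, 2, 0], by ext <;> simp [ofCoords]⟩⟩,
    ⟨?_, ?_, by
      rw [show (⟨3/2, 5/2, 3/2, 1/2⟩ : ℍ[ℚ,((-1 : ℤ) : ℚ),((3 : ℤ) : ℚ)]) - ⟨1/2, 1/2, 1/2, -1/2⟩ = ⟨1, 2, 1, 1⟩ by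
        rw [QuaternionAlgebra.mk_sub_mk]; ext <;> norm_num]
      exact ⟨![1, 2, 1, 1], by ext <;> simp [ofCoords]⟩⟩,
    ⟨?_, ?_, by
      rw [show (⟨1/2, 3/2, 1/2, 1/2⟩ : ℍ[ℚ,((-1 : ℤ) : ℚ),((3 : ℤ) : ℚ)]) - ⟨1/2, 1/2, 1/2, -1/2⟩ = ⟨0, 1, 0, 1⟩ by
        rw [QuaternionAlgebra.mk_sub_mk]; ext <;> norm_num]
      exact ⟨![0, 1, 0, 1], by ext <;> simp [ofCoords]⟩⟩⟩
  all_goals first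
    | (rewrite [QuaternionAlgebra.mk_mul_mk]; ext <;> norm_num)
    | (rw [QuaternionAlgebra.star_mk, QuaternionAlgebra.mk_mul_mk]; norm_num)

/-! ## §4 Non-fixedness -/

/-- **`ω₂` AND `ω₃` MOVE THE SCM POINTS**: no `g ∈ O₆` of norm `2` or `3` commutes or anticommutes with `S₁ = 3i + j` or with `S₂ =
3i + ij` — commuting would put `g` in `ℚ(Sₖ) ∩ O₆` with `nr g = (n₀² + 6n²)/4 ∈ {2, 3}`, i.e. `n₀² + 6n² ∈ {8, 12}` (impossible),
anticommuting is excluded by §2. With §3 (`ω₆` fixes them) and g32-#1 (`Stab_{Γ₆}(S₁) = ±1`): **«`P₀` is an elliptic point for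
`X₆^{(6)}` and `X₆⁺`, but it is not elliptic for `X₆`, `X₆^{(2)}` and `X₆^{(3)}`»**, and the same for `P₇`. [cite: BayerTravesa2007, §7 p. 332] [cite: KudlaRapoportYang2006, §3.4 Lemma 3.4.3] -/
theorem not_fixed_scm_of_norm_two_or_three {g : ℍ[ℚ,((-1 : ℤ) : ℚ),((3 : ℤ) : ℚ)]}
    (hg : g ∈ order (-1) 3 ∨ g - ⟨1/2, 1/2, 1/2, -1/2⟩ ∈ order (-1) 3)
    (hn : (g * star g).re = 2 ∨ (g * star g).re = 3) :
    (g * ⟨0, 3, 1, 0⟩ ≠ ⟨0, 3, 1, 0⟩ * g ∧ g * ⟨0, 3, 1, 0⟩ ≠ -(⟨0, 3, 1, 0⟩ * g)) ∧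
    (g * ⟨0, 3, 0, 1⟩ ≠ ⟨0, 3, 0, 1⟩ * g ∧ g * ⟨0, 3, 0, 1⟩ ≠ -(⟨0, 3, 0, 1⟩ * g)) := by
  have hpos : ¬ (g * star g).re ≤ 0 := by rcases hn with hn | hn <;> rw [hn] <;> norm_num
  obtain ⟨n, hgn, -, -, -⟩ := (maxOrder_iff_exists_halfCoords g).1 hg
  refine ⟨⟨fun h ↦ ?_, fun h ↦ hpos (norm_nonpos_of_anticommute (by norm_num) h)⟩,
    ⟨fun h ↦ ?_, fun h ↦ hpos (norm_nonpos_of_anticommute (by norm_num) h)⟩⟩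
  · have e := norm_of_commute_pure h
    rw [hgn] at e hn
    dsimp only at e
    have key : (n 0 : ℚ) ^ 2 + 6 * (n 2 : ℚ) ^ 2 = 8 ∨ (n 0 : ℚ) ^ 2 + 6 * (n 2 : ℚ) ^ 2 = 12 := by
      rcases hn with hn | hn
      · left; linear_combination 4 * (e.symm.trans hn)
      · right; linear_combination 4 * (e.symm.trans hn)
    rcases key with k | k
    · exact sq_forms_ne.1.1 (by exact_mod_cast k)
    · exact sq_forms_ne.1.2 (by exact_mod_cast k)
  · have e := norm_of_commute_pure_k h
    rw [hgn] at e hn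
    dsimp only at e
    have key : (n 0 : ℚ) ^ 2 + 6 * (n 3 : ℚ) ^ 2 = 8 ∨ (n 0 : ℚ) ^ 2 + 6 * (n 3 : ℚ) ^ 2 = 12 := by
      rcases hn with hn | hn
      · left; linear_combination 4 * (e.symm.trans hn)
      · right; linear_combination 4 * (e.symm.trans hn)
    rcases key with k | k
    · exact sq_forms_ne.1.1 (by exact_mod_cast k)
    · exact sq_forms_ne.1.2 (by exact_mod_cast k)

/-- **`ω₃` AND `ω₆` MOVE THE ORDER-`2` POINTS**: no `g ∈ O₆` of norm `3` or `6` commutes or anticommutes with `i` or with `E = −2i + ij`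
(commuting: `g ∈ ℚ(i)` resp. `ℚ(E)`, `nr g = (n₀² + n²)/4 ∈ {3, 6}`, i.e. `n₀² + n² ∈ {12, 24}` — not sums of two squares) — `P₆`,
`P₁₃₅` are elliptic for `ω₂` only (order `4` on `X₆^{(2)}`, `X₆⁺`). [cite: BayerTravesa2007, §2 p. 319 («`ω₃[P₂, P₃, P₆] = [P₂, P₆, P₁]`», «`ω₆[P₂, P₃, P₆] = [P₄, P₆, P₃]`») and Table 9 (`e_{P₆} = 4`)] -/
theorem not_fixed_orderTwo_of_norm_three_or_six {g : ℍ[ℚ,((-1 : ℤ) : ℚ),((3 : ℤ) : ℚ)]}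
    (hg : g ∈ order (-1) 3 ∨ g - ⟨1/2, 1/2, 1/2, -1/2⟩ ∈ order (-1) 3)
    (hn : (g * star g).re = 3 ∨ (g * star g).re = 6) :
    (g * ⟨0, 1, 0, 0⟩ ≠ ⟨0, 1, 0, 0⟩ * g ∧ g * ⟨0, 1, 0, 0⟩ ≠ -(⟨0, 1, 0, 0⟩ * g)) ∧
    (g * ⟨0, -2, 0, 1⟩ ≠ ⟨0, -2, 0, 1⟩ * g ∧ g * ⟨0, -2, 0, 1⟩ ≠ -(⟨0, -2, 0, 1⟩ * g)) := by
  have hpos : ¬ (g * star g).re ≤ 0 := by rcases hn with hn | hn <;> rw [hn] <;> norm_num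
  obtain ⟨n, hgn, -, -, -⟩ := (maxOrder_iff_exists_halfCoords g).1 hg
  refine ⟨⟨fun h ↦ ?_, fun h ↦ hpos (norm_nonpos_of_anticommute (by norm_num) h)⟩,
    ⟨fun h ↦ ?_, fun h ↦ hpos (norm_nonpos_of_anticommute (by norm_num) h)⟩⟩
  · obtain ⟨h2, h3⟩ := (commute_anticommute_i_iff g).1.1 h
    rw [hgn] at h2 h3 hn
    dsimp only at h2 h3 hn
    rw [QuaternionAlgebra.star_mk, QuaternionAlgebra.mk_mul_mk] at hn
    push_cast at hn
    rw [h2, h3] at hn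
    have key : (n 0 : ℚ) ^ 2 + (n 1 : ℚ) ^ 2 = 12 ∨ (n 0 : ℚ) ^ 2 + (n 1 : ℚ) ^ 2 = 24 := by
      rcases hn with hn | hn
      · left; linear_combination 4 * hn
      · right; linear_combination 4 * hn
    rcases key with k | k
    · exact sq_forms_ne.2.1.1 (by exact_mod_cast k)
    · exact sq_forms_ne.2.1.2 (by exact_mod_cast k)
  · have e := norm_of_commute_pure_k h
    rw [hgn] at e hn
    dsimp only at e
    have key : (n 0 : ℚ) ^ 2 + (n 3 : ℚ) ^ 2 = 12 ∨ (n 0 : ℚ) ^ 2 + (n 3 : ℚ) ^ 2 = 24 := by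
      rcases hn with hn | hn
      · left; linear_combination 4 * (e.symm.trans hn)
      · right; linear_combination 4 * (e.symm.trans hn)
    rcases key with k | k
    · exact sq_forms_ne.2.1.1 (by exact_mod_cast k)
    · exact sq_forms_ne.2.1.2 (by exact_mod_cast k)

/-- **`ω₂` AND `ω₆` MOVE THE ORDER-`3` POINTS**: no `g ∈ O₆` of norm `2` or `6` commutes or anticommutes with `R₁ = 3i + j + ij` or
`R₂ = 3i + j − ij` (commuting: `nr g = (n₀² + 3n²)/4 ∈ {2, 6}`, `n₀² + 3n² ∈ {8, 24}` impossible) — `P₂`, `P₄` are elliptic for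
`ω₃` only (order `6` on `X₆^{(3)}`, `X₆⁺`). [cite: BayerTravesa2007, §2 p. 319 («`ω₂[P₁, P₂, P₆] = [P₃, P₄, P₆]`», «`ω₆[P₂, P₃, P₆] = [P₄, P₆, P₃]`») and Table 9 (`e_{P₄} = 6`)] -/
theorem not_fixed_orderThree_of_norm_two_or_six {g : ℍ[ℚ,((-1 : ℤ) : ℚ),((3 : ℤ) : ℚ)]}
    (hg : g ∈ order (-1) 3 ∨ g - ⟨1/2, 1/2, 1/2, -1/2⟩ ∈ order (-1) 3)
    (hn : (g * star g).re = 2 ∨ (g * star g).re = 6) :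
    (g * ⟨0, 3, 1, 1⟩ ≠ ⟨0, 3, 1, 1⟩ * g ∧ g * ⟨0, 3, 1, 1⟩ ≠ -(⟨0, 3, 1, 1⟩ * g)) ∧
    (g * ⟨0, 3, 1, -1⟩ ≠ ⟨0, 3, 1, -1⟩ * g ∧ g * ⟨0, 3, 1, -1⟩ ≠ -(⟨0, 3, 1, -1⟩ * g)) := by
  have hpos : ¬ (g * star g).re ≤ 0 := by rcases hn with hn | hn <;> rw [hn] <;> norm_num
  obtain ⟨n, hgn, -, -, -⟩ := (maxOrder_iff_exists_halfCoords g).1 hg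
  refine ⟨⟨fun h ↦ ?_, fun h ↦ hpos (norm_nonpos_of_anticommute (by norm_num) h)⟩,
    ⟨fun h ↦ ?_, fun h ↦ hpos (norm_nonpos_of_anticommute (by norm_num) h)⟩⟩
  · have e := norm_of_commute_pure h
    rw [hgn] at e hn
    dsimp only at e
    have key : (n 0 : ℚ) ^ 2 + 3 * (n 2 : ℚ) ^ 2 = 8 ∨ (n 0 : ℚ) ^ 2 + 3 * (n 2 : ℚ) ^ 2 = 24 := by
      rcases hn with hn | hn
      · left; linear_combination 4 * (e.symm.trans hn)
      · right; linear_combination 4 * (e.symm.trans hn)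
    rcases key with k | k
    · exact sq_forms_ne.2.2.1 (by exact_mod_cast k)
    · exact sq_forms_ne.2.2.2 (by exact_mod_cast k)
  · have e := norm_of_commute_pure h
    rw [hgn] at e hn
    dsimp only at e
    have key : (n 0 : ℚ) ^ 2 + 3 * (n 2 : ℚ) ^ 2 = 8 ∨ (n 0 : ℚ) ^ 2 + 3 * (n 2 : ℚ) ^ 2 = 24 := by
      rcases hn with hn | hn
      · left; linear_combination 4 * (e.symm.trans hn)
      · right; linear_combination 4 * (e.symm.trans hn)
    rcases key with k | k
    · exact sq_forms_ne.2.2.1 (by exact_mod_cast k)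
    · exact sq_forms_ne.2.2.2 (by exact_mod_cast k)

/-! ## §5 Isotropy elements on `X₆⁺` -/

/-- **ELEMENTS OF THE PRINTED ORDERS IN THE ISOTROPY GROUPS OF `X₆⁺`** (modulo `ℚ^×`): at `P₆ = z_i`, `1 + i ∈ Γ₆w₂` with `(1 + i)² =
2i ∉ ℚ·1` and `(1 + i)⁴ = −4` (order `4`: `e_{P₆} = 4`); at `P₀ = z_{S₂}`, `S₂ = w₆` with `S₂² = −6` (order `2`: `e_{P₀} = 2`, although
`Stab_{Γ₆}(S₂) = ±1`); at `P₄ = z_{R₁}`, `γ = R₁u₄ = (−3 + 3i + j + ij)/2 ∈ Γ₆w₃` (`u₄ = (1 + R₁)/2 ∈ Γ₆`, `u₄³ = −1`) with `γ² = (3 −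
9i − 3j − 3ij)/2 ∉ ℚ·1`, `γ³ = 3R₁ ∉ ℚ·1`, `γ⁶ = −27` (order `6`: `e_{P₄} = 6`). [cite: BayerTravesa2007, Table 9 (triangle `[P₀, P₄, P₆]` of `t₆⁺`: `e = 2, 6, 4`) and §7 p. 332] -/
theorem isotropy_elements :
    ((⟨1, 1, 0, 0⟩ : ℍ[ℚ,((-1 : ℤ) : ℚ),((3 : ℤ) : ℚ)]) ^ 2 = ⟨0, 2, 0, 0⟩ ∧
      (⟨1, 1, 0, 0⟩ : ℍ[ℚ,((-1 : ℤ) : ℚ),((3 : ℤ) : ℚ)]) ^ 4 = ⟨-4, 0, 0, 0⟩ ∧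
      ∀ c : ℚ, (⟨0, 2, 0, 0⟩ : ℍ[ℚ,((-1 : ℤ) : ℚ),((3 : ℤ) : ℚ)]) ≠ ⟨c, 0, 0, 0⟩) ∧
    ((⟨0, 3, 0, 1⟩ : ℍ[ℚ,((-1 : ℤ) : ℚ),((3 : ℤ) : ℚ)]) ^ 2 = ⟨-6, 0, 0, 0⟩ ∧
      ∀ c : ℚ, (⟨0, 3, 0, 1⟩ : ℍ[ℚ,((-1 : ℤ) : ℚ),((3 : ℤ) : ℚ)]) ≠ ⟨c, 0, 0, 0⟩) ∧
    ((⟨-3/2, 3/2, 1/2, 1/2⟩ : ℍ[ℚ,((-1 : ℤ) : ℚ),((3 : ℤ) : ℚ)]) = ⟨0, 3, 1, 1⟩ * ⟨1/2, 3/2, 1/2, 1/2⟩ ∧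
      (⟨1/2, 3/2, 1/2, 1/2⟩ : ℍ[ℚ,((-1 : ℤ) : ℚ),((3 : ℤ) : ℚ)]) ^ 3 = ⟨-1, 0, 0, 0⟩ ∧
      (⟨-3/2, 3/2, 1/2, 1/2⟩ : ℍ[ℚ,((-1 : ℤ) : ℚ),((3 : ℤ) : ℚ)]) ^ 2 = ⟨3/2, -9/2, -3/2, -3/2⟩ ∧
      (⟨-3/2, 3/2, 1/2, 1/2⟩ : ℍ[ℚ,((-1 : ℤ) : ℚ),((3 : ℤ) : ℚ)]) ^ 3 = ⟨0, 9, 3, 3⟩ ∧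
      (⟨-3/2, 3/2, 1/2, 1/2⟩ : ℍ[ℚ,((-1 : ℤ) : ℚ),((3 : ℤ) : ℚ)]) ^ 6 = ⟨-27, 0, 0, 0⟩ ∧
      (∀ c : ℚ, (⟨3/2, -9/2, -3/2, -3/2⟩ : ℍ[ℚ,((-1 : ℤ) : ℚ),((3 : ℤ) : ℚ)]) ≠ ⟨c, 0, 0, 0⟩) ∧
      ∀ c : ℚ, (⟨0, 9, 3, 3⟩ : ℍ[ℚ,((-1 : ℤ) : ℚ),((3 : ℤ) : ℚ)]) ≠ ⟨c, 0, 0, 0⟩) := by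
  have hne : ∀ (a₀ a₁ a₂ a₃ : ℚ), a₁ ≠ 0 → ∀ c : ℚ, (⟨a₀, a₁, a₂, a₃⟩ : ℍ[ℚ,((-1 : ℤ) : ℚ),((3 : ℤ) : ℚ)]) ≠ ⟨c, 0, 0, 0⟩ := by
    intro a₀ a₁ a₂ a₃ ha c h
    exact ha (by simpa using congrArg QuaternionAlgebra.imI h)
  have sq : ∀ q : ℍ[ℚ,((-1 : ℤ) : ℚ),((3 : ℤ) : ℚ)], q ^ 2 = q * q := fun q ↦ pow_two q
  have p3 : ∀ q : ℍ[ℚ,((-1 : ℤ) : ℚ),((3 : ℤ) : ℚ)], q ^ 3 = q * q * q := fun q ↦ by rw [pow_succ, pow_two]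
  have p4 : ∀ q : ℍ[ℚ,((-1 : ℤ) : ℚ),((3 : ℤ) : ℚ)], q ^ 4 = (q * q) * (q * q) := fun q ↦ by
    rw [show 4 = 2 + 2 by norm_num, pow_add, pow_two]
  have p6 : ∀ q : ℍ[ℚ,((-1 : ℤ) : ℚ),((3 : ℤ) : ℚ)], q ^ 6 = (q * q * q) * (q * q * q) := fun q ↦ by
    rw [show 6 = 3 + 3 by norm_num, pow_add, p3]
  refine ⟨⟨?_, ?_, hne _ _ _ _ (by norm_num)⟩, ⟨?_, hne _ _ _ _ (by norm_num)⟩,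
    ⟨?_, ?_, ?_, ?_, ?_, hne _ _ _ _ (by norm_num), hne _ _ _ _ (by norm_num)⟩⟩
  all_goals first
    | (rw [sq, QuaternionAlgebra.mk_mul_mk]; ext <;> norm_num)
    | (rw [p4, QuaternionAlgebra.mk_mul_mk, QuaternionAlgebra.mk_mul_mk]; ext <;> norm_num)
    | (rw [QuaternionAlgebra.mk_mul_mk]; ext <;> norm_num)
    | (rw [p3, QuaternionAlgebra.mk_mul_mk, QuaternionAlgebra.mk_mul_mk]; ext <;> norm_num)
    | (rw [p6, QuaternionAlgebra.mk_mul_mk, QuaternionAlgebra.mk_mul_mk, QuaternionAlgebra.mk_mul_mk]; ext <;> norm_num)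

end AtkinLehnerPoints

end Literature.Geometry.Kaehler.ComplexTorus.QuaternionType
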